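import Literature.MathematicalPhysics.QuantumFieldTheory.Balaban1983to89.B9Eq346MixedLegAtCubesTorusL2

/-!
# `Balaban1983to89.B9Eq346OneSidedLegsAtCubesTorusL2` — T. Bałaban, *Propagators for lattice gauge theories in a background field*, Commun. Math. Phys. **99**
# (1985) 389–434 [Balaban1985BackgroundPropagators] Cor 3.6 p. 408 ∕ (3.46) p. 398 ∕ (3.87)–(3.89) p. 409, by S. Agmon's method [Agmon1982]: ★★ **THE TWO ONE-SIDED `L²`
# LEGS `∇_{U,ν} G′_□(U) h_□ ∇*_{U,μ}` AND `G′_□(U) h_□ ∇*_{U,μ}` OF THE THEOREM-3.7 WALK — the letter-free inputs `hMix`, `hOne` of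
# `B9RWSums346MixedFactorFromLegs.factorsL2Mixed37Dir_of_letterL2_legs` — AT THE SHIFTED MULTI-SCALE EXPONENT, THEN AT THE GENUINE CUT-OFF `h_□ = hTY` AND DOMAIN
# `□̃(c) = cubeDomY`, BLOCK TO BLOCK, WITH MEMBER- AND □-UNIFORM CONSTANTS** (dag-n06-w1's `B9Thm31SiteGsqCutoffMixedReg335Y` §C3 read at the torus block distance)

statement-level skeleton of published theorems with citation tags; proofs where landed; nothing here is a claim about the Yang–Mills mass gap

THE PRINT.  (3.46) p. 398: *«‖h∇_UG′(U)∇\*_Uλ‖ ≤ B₀·1·e^{−δ₀d(y,y′)}‖h‖‖λ‖, ‖hG′(U)∇\*_Uλ‖ ≤ B₀·Lʲη·…»*; Cor 3.6 p. 408: the estimates hold for `G′_□(U)` *«with constants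
independent of □»*; (3.88)–(3.89) p. 409: the factor `K(h_□)G′_□h_□` of `R′`; [4] p. 247: *«|∂h_□| ≤ O(1)(MLʲη)⁻¹»*; [4] (2.46) p. 231 (the block distance).

WHY THIS FILE (cell `pub-ymgap`, Track A node N06 [B9], rows 18; width seat `pub-ymgap-dag-n06-w7`, g1, 2026-08-28).  The sibling `B9RWSums346MixedFactorFromLegs`
derives rows 18's third-order mixed factor schema `FactorsL2Mixed37Dir` from letter bounds and TWO LETTER-FREE `L²` LEGS of the pinned objects: the uncut mixed leg
`∇_{U,ν}G′_□M_{h_□}∇\*_{U,μ}` (`hMix`, scale-free) and the first-order leg `G′_□M_{h_□}∇\*_{U,μ}` (`hOne`, one power of `Lʲη`).  Their analytic content on the (3.35)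
class is dag-n06-w1's `B9Thm31SiteGsqCutoffMixedReg335Y.hs_restrict_cdS_GsqY_cutMulY_cdsS_le` ∕ `hs_restrict_GsqY_cutMulY_cdsS_le` (any `D`, any real cut-off `h`, any
admissible Agmon weight).  THIS FILE reads them at the torus block distance — the twin of `B9Thm31SiteGsqBlockDistReg335Y.hs_restrict_cdS_cutMulY_GsqY_cutMulY_cdsS_le_distT`
(both cut-offs) and of this seat's `B9Eq346MixedLegAtCubesTorusL2` (both cut-offs, uniform constants):
* §1 (any `D`, any `h` with `|h| ≤ 1`, bond differences `≤ κ`; `λ` carried by the block `s`, `A` in blocks at distance `≥ n` from `s`):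
  ★ `hs_restrict_cdS_GsqY_cutMulY_cdsS_le_distT` — `Σ_{z∈A}Σ_ν HS((∇_{U,ν}G′_□(U)M_h∇\*_{U,μ}λ)(z)) ≤ 2·(10 + 160κ²L^{2(lev s+1)}) · ‖λ‖²₁ ∕ (e^{δ₀((n−1)∕(2L) − 1)})²`;
  ★ `hs_restrict_GsqY_cutMulY_cdsS_le_distT` — `Σ_{z∈A} HS((G′_□(U)M_h∇\*_{U,μ}λ)(z)) ≤ 2·(16 + 256κ²L^{2(lev s+1)})·L^{2j_A} · ‖λ‖²₁ ∕ (e^{δ₀((n−1)∕(2L) − 1)})²` (levels `≤ j_A` on `A`).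
* §2 (at `h = hTY c`, `D = cubeDomY x c`, `A = Δ(t)`): `lev_le_of_mem_cubeDomY`, `GsqY_cubeDomY_apply_eq_zero_of_lev` (the local inverse's OUTPUT lives on `□̃(c)`,
  levels `≤ j(c)+1`), ★★ `hs_block_cdS_GsqY_hTY_cdsS_le` — `Σ_{z∈Δ(t)}Σ_ν HS((∇_{U,ν}G′_c(U)M_{h_c}∇\*_{U,μ}λ)(z)) ≤ (20 + 320K)·‖λ‖²₁ ∕ (e^{δ₀((d_T(t,s)−1)∕(2L) − 1)})²` and
  ★★ `hs_block_GsqY_hTY_cdsS_le` — `Σ_{z∈Δ(t)} HS((G′_c(U)M_{h_c}∇\*_{U,μ}λ)(z)) ≤ (32 + 512K)·L^{2 lev t}·‖λ‖²₁ ∕ (e^{δ₀((d_T(t,s)−1)∕(2L) − 1)})²`, `K = (5C₁∕8)²L⁴`,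
  `δ₀ = 1∕(4(d+2))` — print's «constants independent of □», member-uniform (no `M_h`, no `j(c)`, no `k`).
HONEST SCOPE.  Two instantiations + level bookkeeping on top of landed files; the analytic input is dag-n06-w1's theorems (proved, hypothesis-free on the (3.35) class);
nothing of [B9] beyond them is asserted; the coordinate ∕ block-`L²` reading at the knit's models is the sequel `B9Eq346OneSidedLegsAtPinsL2`.  Count-neutral; N06 NOT
discharged; K1⁹ NOT closed; one finite lattice at a time — nothing continuum ∕ OS ∕ mass gap ∕ Clay.  NEW file; imports ONE built module; nothing landed is modified.
-/

noncomputable section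

namespace Literature.MathematicalPhysics.QuantumFieldTheory.Balaban1983to89.B9Eq346OneSidedLegsAtCubesTorusL2

open Literature.MathematicalPhysics.QuantumFieldTheory.Balaban1983to89
open Node00 B6KLevelCensusIndexV1 B6Geom246MultiLevelBox B6MultiLevelBoxOperator B6MultiLevelTorusOperator B6GlobalChartV1 B9BackgroundsKLevelV1
  B9Eq39Adjoint B9Thm311ReadingCoords B6Geom246MultiLevelTorus B9Thm31SiteGsqBlockDistReg335Y B9Thm31SiteGsqRecordCutoffReg335Y B9Thm31SiteGsqCutoffMixedReg335Y
  B9Thm31SiteAgmonWeightY B9Eq346MixedLegAtCubesTorusL2 B6AgmonExponentMultiLevelTorus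
open Literature.MathematicalPhysics.QuantumFieldTheory.Balaban1983to89.B9Thm37CubeCoverCommutatorSizes (abs_hTY_shiftY_sub_le)
open Literature.MathematicalPhysics.QuantumFieldTheory.Balaban1983to89.B9Eq346GradGpDivTorusL2 (msRhoYPos_bond msRhoYPos_bond' msRhoYPos_block msRhoYPos_eq_zero
  msRhoYPos_eq_zero_shift msRhoYPos_ge msRhoYPos_ge_of_le)
open Literature.MathematicalPhysics.QuantumFieldTheory.Balaban1983to89.B9Ineq369CurvatureSmallAtLettersY (hs_nonneg)
open Literature.MathematicalPhysics.QuantumFieldTheory.Balaban1983to89.B9Thm311DeltaPrimePos (trIP_self_nonneg)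
open Literature.MathematicalPhysics.QuantumFieldTheory.Balaban1983to89.B9Thm37CubeCoverCommutators (cutMulY cutMulY_apply hTY hTY_apply one_le_Mh_and_P)
open Literature.MathematicalPhysics.QuantumFieldTheory.Balaban1983to89.B6Partition118KLevelFineSizes (C1F C1F_nonneg)
open Literature.MathematicalPhysics.QuantumFieldTheory.Balaban1983to89.B6Cover236MultiLevelBlocks (cubes)
open Literature.MathematicalPhysics.QuantumFieldTheory.Balaban1983to89.B6Cover236QbigOverlapV1 (window_and_congr_of_mem_QbigT)
open Literature.MathematicalPhysics.QuantumFieldTheory.Balaban1983to89.B9WalkLettersCoordsS (cubeBlksY cubeDomY two_le_Mh four_le_P two_L_le_R mem_cubeDomY_of_hTY_ne_zero)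
open Literature.MathematicalPhysics.QuantumFieldTheory.Balaban1983to89.B6Partition118KLevelTorusCentral (QbigT)
open Literature.MathematicalPhysics.QuantumFieldTheory.Balaban1983to89.B9PinMembersKLevelV1 (MemberY geo9Y)
open Literature.MathematicalPhysics.QuantumFieldTheory.Balaban1983to89.Node00.OpsYLocalInverse (GsqY GsqY_apply_eq_zero)
open Literature.MathematicalPhysics.QuantumFieldTheory.Balaban1983to89.Node00.OpsYNablaBridge (cdS_apply cdsS_apply)
open scoped Matrix Matrix.Norms.L2Operator

variable {d ℓ : ℕ} {hd : 1 ≤ d + 1} {hL : Odd (ℓ + 1) ∧ 1 < ℓ + 1} {b₀ b₁ : ℝ}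

/-! ## §1 The one-sided legs at the shifted multi-scale exponent (any domain, any real cut-off) -/

section General

variable (i : KIdx d ℓ hd hL b₀ b₁) {N : ℕ} {G : Subgroup (Matrix (Fin N) (Fin N) ℂ)ˣ}

/-- the exponent bookkeeping shared by both legs: `δ₀ = 1∕(4(d+2))` obeys `0 ≤ δ₀ ≤ 1`, `δ₀(d+1) ≤ 1` and the weight-ratio budget
`(d+1)·2δ₀² + 2δ₀²(d+1)²∕2 ≤ 1∕16` of dag-n06-w1's files 22∕23. [cite: Balaban1985BackgroundPropagators, p.397 («δ₀ … sufficiently small»), bookkeeping] -/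
private theorem delta0_facts (d : ℕ) :
    (0 : ℝ) ≤ 1 / (4 * ((d : ℝ) + 2)) ∧ 1 / (4 * ((d : ℝ) + 2)) ≤ 1 ∧ 1 / (4 * ((d : ℝ) + 2)) * ((d : ℝ) + 1) ≤ 1 ∧
      ((d : ℝ) + 1) * (2 * (1 / (4 * ((d : ℝ) + 2))) ^ 2) + (2 * (1 / (4 * ((d : ℝ) + 2))) ^ 2 * ((d : ℝ) + 1) ^ 2) / 2 ≤ 1 / 16 := by
  have hd0 : (0 : ℝ) ≤ d := Nat.cast_nonneg d
  have hd2 : (0 : ℝ) < 4 * ((d : ℝ) + 2) := by positivity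
  refine ⟨by positivity, by rw [div_le_one hd2]; linarith, by rw [div_mul_eq_mul_div, one_mul, div_le_one hd2]; linarith, ?_⟩
  have hδκ0 : (1 / (4 * ((d : ℝ) + 2))) ^ 2 * (2 * ((d : ℝ) + 1) + ((d : ℝ) + 1) ^ 2) ≤ 1 / 16 := by
    rw [div_pow, one_pow, mul_pow, one_div_mul_eq_div, div_le_iff₀ (by positivity)]; nlinarith
  have e : ((d : ℝ) + 1) * (2 * (1 / (4 * ((d : ℝ) + 2))) ^ 2) + (2 * (1 / (4 * ((d : ℝ) + 2))) ^ 2 * ((d : ℝ) + 1) ^ 2) / 2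
      = (1 / (4 * ((d : ℝ) + 2))) ^ 2 * (2 * ((d : ℝ) + 1) + ((d : ℝ) + 1) ^ 2) := by ring
  rw [e]; exact hδκ0

variable [Nonempty (Fin N)]

/-- ★ **THE UNCUT MIXED LEG `∇_{U,ν}G′_□(U)M_h∇\*_{U,μ}` AT THE SHIFTED MULTI-SCALE EXPONENT**: on the class, ANY `D`, ANY real cut-off `h` (`|h| ≤ 1`, bond differences `≤ κ`),
for `λ` carried by the block `s` and `A` in blocks at block distance `≥ n` from `s`,
`Σ_{z∈A}Σ_ν HS((∇_{U,ν}G′_□(U)M_h∇\*_{U,μ}λ)(z)) ≤ 2·(10 + 160κ²L^{2(lev s+1)}) · ‖λ‖²₁ ∕ (e^{δ₀((n−1)∕(2L) − 1)})²`, `δ₀ = 1∕(4(d+2))` — no dependence on the levels of `A`.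
[cite: Balaban1985BackgroundPropagators, Cor 3.6 p.408, (3.46) p.398, (3.87)–(3.89) p.409; Balaban1984PropagatorsII, (2.39)–(2.44) pp.229–230, (2.46) p.231; Agmon1982, Ch.1, Thm 1.5] -/
theorem hs_restrict_cdS_GsqY_cutMulY_cdsS_le_distT (hG : G ≤ B7Prop2Explicit.unitaryUnits (Matrix (Fin N) (Fin N) ℂ))
    {U : CfgY (Matrix (Fin N) (Fin N) ℂ) i} {c α₀ : ℝ} (hC0 : 0 ≤ c * (kGeo i).M * α₀) (hC1 : c * (kGeo i).M * α₀ * ((d : ℝ) + 1) ≤ 1 / 16)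
    (hreg : (bg9K (Matrix (Fin N) (Fin N) ℂ) G i).Reg335 c α₀ U) (D : Finset (SiteY i))
    {h : SiteY i → ℝ} {κ : ℝ} (hh1 : ∀ z, |h z| ≤ 1) (hhκ : ∀ μ z, |h (shiftY i μ z) - h z| ≤ κ) (μ : Fin (d + 1)) (s : BlkY i)
    {A : Finset (SiteY i)} {Λ : SiteY i → Matrix (Fin N) (Fin N) ℂ} (hΛ : ∀ z, blkOf i.D.toDomains z ≠ s → Λ z = 0)
    {n : ℕ} (hA : ∀ z ∈ A, n ≤ (bondT i.D).dist (blkOf i.D.toDomains z) s) :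
    ∑ z ∈ A, ∑ ν : Fin (d + 1), ∑ a, ∑ b, ‖cdS i U ν (GsqY i (parSymY i) D U (cutMulY h (cdsS i U μ Λ))) z a b‖ ^ 2
      ≤ 2 * (10 + 160 * κ ^ 2 * ((((ℓ + 1) ^ (s.1.1 + 1) : ℕ) : ℝ)) ^ 2)
        / Real.exp ((1 / (4 * ((d : ℝ) + 2))) * (((((n : ℝ)) - 1) / (2 * ((ℓ + 1 : ℕ) : ℝ)) - 1))) ^ 2 * trIP (fun _ => (1 : ℝ)) Λ Λ := by
  classical
  obtain ⟨hΛB, hΛB', hρB, hjB⟩ := srcSet_facts i μ s hΛ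
  obtain ⟨hδ0, hδ1, hδD, hδκ⟩ := delta0_facts d
  set ρ : SiteY i → ℝ := fun z => max (msRhoT i.D s z - 1) 0 with hρ
  have hω : ∀ z, 0 < Real.exp (1 / (4 * ((d : ℝ) + 2)) * ρ z) := fun z => Real.exp_pos _
  have hωB : ∀ z ∈ Finset.univ.filter (fun z => blkOf i.D.toDomains z = s ∨ blkOf i.D.toDomains ((shiftY i μ).symm z) = s),
      Real.exp (1 / (4 * ((d : ℝ) + 2)) * ρ z) = 1 := fun z hz => by rw [hρ]; simp only []; rw [hρB z hz, mul_zero, Real.exp_zero]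
  have hW : ∀ z ∈ A, Real.exp (1 / (4 * ((d : ℝ) + 2)) * (((((n : ℝ)) - 1) / (2 * ((ℓ + 1 : ℕ) : ℝ)) - 1))) ≤ Real.exp (1 / (4 * ((d : ℝ) + 2)) * ρ z) :=
    fun z hz => Real.exp_le_exp.2 (mul_le_mul_of_nonneg_left (msRhoYPos_ge_of_le i s hA z hz) hδ0)
  exact hs_restrict_cdS_GsqY_cutMulY_cdsS_le i hG hC0 hC1 hreg D hω (by positivity) (by positivity)
    (fun μ' z => bondRatio_exp_le i hδ0 hδ1 μ' z (msRhoYPos_bond i s μ' z)) (fun μ' z => bondRatio_exp_le' i hδ0 hδ1 μ' z (msRhoYPos_bond' i s μ' z))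
    (fun z w hzw => blockOsc_exp_le i hδ0 hδD z w (msRhoYPos_block i s z w hzw)) hδκ hh1 hhκ μ hΛB hΛB' hωB hjB (Real.exp_pos _) hW

/-- ★ **THE FIRST-ORDER LEG `G′_□(U)M_h∇\*_{U,μ}` AT THE SHIFTED MULTI-SCALE EXPONENT**: on the class, ANY `D`, ANY real cut-off `h` (`|h| ≤ 1`, bond differences `≤ κ`), for
`λ` carried by the block `s` and `A` in blocks at block distance `≥ n` from `s` with levels `≤ j_A`,
`Σ_{z∈A} HS((G′_□(U)M_h∇\*_{U,μ}λ)(z)) ≤ 2·(16 + 256κ²L^{2(lev s+1)})·L^{2j_A} · ‖λ‖²₁ ∕ (e^{δ₀((n−1)∕(2L) − 1)})²`.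
[cite: Balaban1985BackgroundPropagators, Cor 3.6 p.408, (3.46) p.398, (3.87)–(3.89) p.409; Balaban1984PropagatorsII, (2.39)–(2.44) pp.229–230, (2.46) p.231; Agmon1982, Ch.1, Thm 1.5] -/
theorem hs_restrict_GsqY_cutMulY_cdsS_le_distT (hG : G ≤ B7Prop2Explicit.unitaryUnits (Matrix (Fin N) (Fin N) ℂ))
    {U : CfgY (Matrix (Fin N) (Fin N) ℂ) i} {c α₀ : ℝ} (hC0 : 0 ≤ c * (kGeo i).M * α₀) (hC1 : c * (kGeo i).M * α₀ * ((d : ℝ) + 1) ≤ 1 / 16)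
    (hreg : (bg9K (Matrix (Fin N) (Fin N) ℂ) G i).Reg335 c α₀ U) (D : Finset (SiteY i))
    {h : SiteY i → ℝ} {κ : ℝ} (hh1 : ∀ z, |h z| ≤ 1) (hhκ : ∀ μ z, |h (shiftY i μ z) - h z| ≤ κ) (μ : Fin (d + 1)) (s : BlkY i)
    {A : Finset (SiteY i)} {Λ : SiteY i → Matrix (Fin N) (Fin N) ℂ} (hΛ : ∀ z, blkOf i.D.toDomains z ≠ s → Λ z = 0)
    {n : ℕ} (hA : ∀ z ∈ A, n ≤ (bondT i.D).dist (blkOf i.D.toDomains z) s) {jA : ℕ} (hjA : ∀ z ∈ A, (blkOf i.D.toDomains z).1.1 ≤ jA) :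
    ∑ z ∈ A, ∑ a, ∑ b, ‖GsqY i (parSymY i) D U (cutMulY h (cdsS i U μ Λ)) z a b‖ ^ 2
      ≤ 2 * ((16 + 256 * κ ^ 2 * ((((ℓ + 1) ^ (s.1.1 + 1) : ℕ) : ℝ)) ^ 2) * ((((ℓ + 1) ^ jA : ℕ) : ℝ)) ^ 2)
        / Real.exp ((1 / (4 * ((d : ℝ) + 2))) * (((((n : ℝ)) - 1) / (2 * ((ℓ + 1 : ℕ) : ℝ)) - 1))) ^ 2 * trIP (fun _ => (1 : ℝ)) Λ Λ := by
  classical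
  obtain ⟨hΛB, hΛB', hρB, hjB⟩ := srcSet_facts i μ s hΛ
  obtain ⟨hδ0, hδ1, hδD, hδκ⟩ := delta0_facts d
  set ρ : SiteY i → ℝ := fun z => max (msRhoT i.D s z - 1) 0 with hρ
  have hω : ∀ z, 0 < Real.exp (1 / (4 * ((d : ℝ) + 2)) * ρ z) := fun z => Real.exp_pos _
  have hωB : ∀ z ∈ Finset.univ.filter (fun z => blkOf i.D.toDomains z = s ∨ blkOf i.D.toDomains ((shiftY i μ).symm z) = s),
      Real.exp (1 / (4 * ((d : ℝ) + 2)) * ρ z) = 1 := fun z hz => by rw [hρ]; simp only []; rw [hρB z hz, mul_zero, Real.exp_zero]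
  have hW : ∀ z ∈ A, Real.exp (1 / (4 * ((d : ℝ) + 2)) * (((((n : ℝ)) - 1) / (2 * ((ℓ + 1 : ℕ) : ℝ)) - 1))) ≤ Real.exp (1 / (4 * ((d : ℝ) + 2)) * ρ z) :=
    fun z hz => Real.exp_le_exp.2 (mul_le_mul_of_nonneg_left (msRhoYPos_ge_of_le i s hA z hz) hδ0)
  exact hs_restrict_GsqY_cutMulY_cdsS_le i hG hC0 hC1 hreg D hω
    (fun μ' z => bondRatio_exp_le i hδ0 hδ1 μ' z (msRhoYPos_bond i s μ' z)) (fun μ' z => bondRatio_exp_le' i hδ0 hδ1 μ' z (msRhoYPos_bond' i s μ' z))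
    (fun z w hzw => blockOsc_exp_le i hδ0 hδD z w (msRhoYPos_block i s z w hzw)) hδκ hh1 hhκ μ hΛB hΛB' hωB hjA hjB (Real.exp_pos _) hW

end General

/-! ## §2 At the partition of record `h_c = hTY c` and the domain `□̃(c)`: block to block, uniform constants -/

section Record

variable {Mstar : ℕ} (x : MemberY d ℓ hd hL b₀ b₁ Mstar) {N : ℕ} {G : Subgroup (Matrix (Fin N) (Fin N) ℂ)ˣ}

/-- a site of `□̃(c)` sits in a block of level `≤ j(c) + 1` (the window of `□̃`). [cite: Balaban1984PropagatorsII, p.235 («□̃»), bookkeeping] -/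
theorem lev_le_of_mem_cubeDomY (c : ↥(cubes x.toKIdx.D.toDomains)) {z : SiteY x.toKIdx} (hz : z ∈ cubeDomY x c) :
    (blkOf x.toKIdx.D.toDomains z).1.1 ≤ c.1.1 + 1 := by
  unfold cubeDomY at hz
  rw [Finset.mem_filter] at hz
  have hmem : blkOf x.toKIdx.D.toDomains z ∈ QbigT x.toKIdx.D (one_le_Mh_and_P x.toKIdx).1 (four_le_P x) c := hz.2
  exact (window_and_congr_of_mem_QbigT x.toKIdx.D hL (two_le_Mh x) x.toKIdx.hR2 (one_le_Mh_and_P x.toKIdx).1 (four_le_P x) hmem).1.2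

/-- the local inverse's OUTPUT lives on `□̃(c)`: `(G′_c(U)Ψ)(z) = 0` when the block of `z` has level `> j(c) + 1`. [cite: Balaban1985BackgroundPropagators, p.410 («G′_□ … restricted to □̃»); Balaban1984PropagatorsII, p.235, bookkeeping] -/
theorem GsqY_cubeDomY_apply_eq_zero_of_lev (c : ↥(cubes x.toKIdx.D.toDomains)) (U : CfgY (Matrix (Fin N) (Fin N) ℂ) x.toKIdx)
    (Ψ : SiteY x.toKIdx → Matrix (Fin N) (Fin N) ℂ) {z : SiteY x.toKIdx} (hz : c.1.1 + 1 < (blkOf x.toKIdx.D.toDomains z).1.1) :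
    GsqY x.toKIdx (parSymY x.toKIdx) (cubeDomY x c) U Ψ z = 0 :=
  GsqY_apply_eq_zero x.toKIdx (parSymY x.toKIdx) U Ψ (fun h => absurd (lev_le_of_mem_cubeDomY x c h) (by omega))

/-- ★★ **THE UNCUT MIXED LEG `∇_{U,ν} G′_c(U) h_c ∇\*_{U,μ}` AT THE PARTITION OF RECORD, BLOCK TO BLOCK, UNIFORM CONSTANT**: `G ≤ U(N)`, `N ≥ 1`, `0 ≤ c₀·M·α₀`,
`c₀·M·α₀·(d+1) ≤ 1∕16`, `U ∈ Reg335 c₀ α₀`; for every cube `c`, direction `μ`, blocks `s t` and `λ` carried by `s`: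
`Σ_{z∈Δ(t)}Σ_ν HS((∇_{U,ν}G′_c(U)M_{h_c}∇\*_{U,μ}λ)(z)) ≤ (20 + 320K)·‖λ‖²₁ ∕ (e^{δ₀((d_T(t,s)−1)∕(2L) − 1)})²`, `K = (5C₁∕8)²L⁴`, `δ₀ = 1∕(4(d+2))`.
[cite: Balaban1985BackgroundPropagators, Cor 3.6 p.408, Thm 3.1 (3.46) p.398, (3.87)–(3.89) p.409, p.397; Balaban1984PropagatorsII, (2.46) p.231, p.235, p.247; Agmon1982, Ch.1, Thm 1.5] -/
theorem hs_block_cdS_GsqY_hTY_cdsS_le [Nonempty (Fin N)] (hG : G ≤ B7Prop2Explicit.unitaryUnits (Matrix (Fin N) (Fin N) ℂ))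
    {U : CfgY (Matrix (Fin N) (Fin N) ℂ) x.toKIdx} {c₀ α₀ : ℝ} (hC0 : 0 ≤ c₀ * (geo9Y x).M * α₀) (hC1 : c₀ * (geo9Y x).M * α₀ * ((d : ℝ) + 1) ≤ 1 / 16)
    (hreg : (bg9K (Matrix (Fin N) (Fin N) ℂ) G x.toKIdx).Reg335 c₀ α₀ U) (c : ↥(cubes x.toKIdx.D.toDomains)) (μ : Fin (d + 1)) (s t : BlkY x.toKIdx)
    {Λ : SiteY x.toKIdx → Matrix (Fin N) (Fin N) ℂ} (hΛ : ∀ z, blkOf x.toKIdx.D.toDomains z ≠ s → Λ z = 0) :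
    ∑ z ∈ Finset.univ.filter (fun z => blkOf x.toKIdx.D.toDomains z = t),
        ∑ ν : Fin (d + 1), ∑ a, ∑ b, ‖cdS x.toKIdx U ν (GsqY x.toKIdx (parSymY x.toKIdx) (cubeDomY x c) U
          (cutMulY (hTY x.toKIdx c) (cdsS x.toKIdx U μ Λ))) z a b‖ ^ 2
      ≤ (20 + 320 * ((5 * C1F d ℓ / 8) ^ 2 * (((ℓ + 1 : ℕ) : ℝ)) ^ 4))
          / Real.exp ((1 / (4 * ((d : ℝ) + 2))) * (((((bondT x.toKIdx.D).dist t s : ℝ)) - 1) / (2 * ((ℓ + 1 : ℕ) : ℝ)) - 1)) ^ 2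
        * trIP (fun _ => (1 : ℝ)) Λ Λ := by
  classical
  set K : ℝ := (5 * C1F d ℓ / 8) ^ 2 * (((ℓ + 1 : ℕ) : ℝ)) ^ 4 with hK
  set E : ℝ := Real.exp ((1 / (4 * ((d : ℝ) + 2))) * (((((bondT x.toKIdx.D).dist t s : ℝ)) - 1) / (2 * ((ℓ + 1 : ℕ) : ℝ)) - 1)) with hE
  have hE0 : 0 < E := Real.exp_pos _
  have hK0 : 0 ≤ K := by positivity
  have hQ0 : 0 ≤ trIP (fun _ => (1 : ℝ)) Λ Λ := trIP_self_nonneg _ (fun _ => one_pos) Λ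
  have hRHS0 : 0 ≤ (20 + 320 * K) / E ^ 2 * trIP (fun _ => (1 : ℝ)) Λ Λ := by positivity
  -- the degenerate source level: the leg's input vanishes
  by_cases hs : s.1.1 ≤ c.1.1 + 2
  swap
  · refine le_of_eq_of_le ?_ hRHS0
    refine Finset.sum_eq_zero fun z _ => Finset.sum_eq_zero fun ν _ => ?_
    rw [cutMulY_cdsS_eq_zero_of_lev x c U μ s hΛ (by omega), map_zero]
    have h1 : cdS x.toKIdx U ν (0 : SiteY x.toKIdx → Matrix (Fin N) (Fin N) ℂ) = 0 := by
      rw [← B9Ineq349SiteComposite.cdSL_apply, map_zero]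
    rw [h1]
    change ∑ a, ∑ b, ‖(0 : Matrix (Fin N) (Fin N) ℂ) a b‖ ^ 2 = 0
    simp
  -- the main case: §1 at `h = hTY c`, `D = cubeDomY x c`, `A = Δ(t)`, `n = d_T(t,s)`
  set κ : ℝ := C1F d ℓ / (8 / 5 * (bigSide ℓ x.toKIdx.Mh c.1.1 : ℝ)) with hκ
  have hA : ∀ z ∈ Finset.univ.filter (fun z => blkOf x.toKIdx.D.toDomains z = t), (bondT x.toKIdx.D).dist t s ≤ (bondT x.toKIdx.D).dist (blkOf x.toKIdx.D.toDomains z) s := by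
    intro z hz; rw [Finset.mem_filter] at hz; rw [hz.2]
  have key := hs_restrict_cdS_GsqY_cutMulY_cdsS_le_distT x.toKIdx hG (U := U) hC0 hC1 hreg (cubeDomY x c) (abs_hTY_le_one x.toKIdx c)
    (fun μ' z => abs_hTY_shiftY_sub_le x.toKIdx c μ' z) μ s hΛ hA
  rw [← hκ] at key
  refine key.trans (mul_le_mul_of_nonneg_right (div_le_div_of_nonneg_right ?_ (by positivity)) hQ0)
  -- the level-dependent constant is below `20 + 320K`
  have hpow : ((((ℓ + 1) ^ (s.1.1 + 1) : ℕ) : ℝ)) ^ 2 ≤ ((((ℓ + 1) ^ (c.1.1 + 3) : ℕ) : ℝ)) ^ 2 := by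
    have h1 : (((ℓ + 1) ^ (s.1.1 + 1) : ℕ) : ℝ) ≤ (((ℓ + 1) ^ (c.1.1 + 3) : ℕ) : ℝ) := by exact_mod_cast Nat.pow_le_pow_right (Nat.succ_pos ℓ) (by omega)
    exact pow_le_pow_left₀ (by positivity) h1 2
  have hKc := kappa_sq_pow_le x c.1.1
  rw [← hκ] at hKc
  have hS2 : κ ^ 2 * ((((ℓ + 1) ^ (s.1.1 + 1) : ℕ) : ℝ)) ^ 2 ≤ K := le_trans (mul_le_mul_of_nonneg_left hpow (sq_nonneg κ)) hKc
  nlinarith [hS2, hK0]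

/-- ★★ **THE FIRST-ORDER LEG `G′_c(U) h_c ∇\*_{U,μ}` AT THE PARTITION OF RECORD, BLOCK TO BLOCK, UNIFORM CONSTANT TIMES THE OUTPUT SCALE**: under the same hypotheses,
`Σ_{z∈Δ(t)} HS((G′_c(U)M_{h_c}∇\*_{U,μ}λ)(z)) ≤ (32 + 512K)·L^{2 lev t}·‖λ‖²₁ ∕ (e^{δ₀((d_T(t,s)−1)∕(2L) − 1)})²` — print's one power of `Lʲη` (squared) at the output block.
[cite: Balaban1985BackgroundPropagators, Cor 3.6 p.408, Thm 3.1 (3.46) p.398, (3.87)–(3.89) p.409, p.397; Balaban1984PropagatorsII, (2.46) p.231, p.235, p.247; Agmon1982, Ch.1, Thm 1.5] -/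
theorem hs_block_GsqY_hTY_cdsS_le [Nonempty (Fin N)] (hG : G ≤ B7Prop2Explicit.unitaryUnits (Matrix (Fin N) (Fin N) ℂ))
    {U : CfgY (Matrix (Fin N) (Fin N) ℂ) x.toKIdx} {c₀ α₀ : ℝ} (hC0 : 0 ≤ c₀ * (geo9Y x).M * α₀) (hC1 : c₀ * (geo9Y x).M * α₀ * ((d : ℝ) + 1) ≤ 1 / 16)
    (hreg : (bg9K (Matrix (Fin N) (Fin N) ℂ) G x.toKIdx).Reg335 c₀ α₀ U) (c : ↥(cubes x.toKIdx.D.toDomains)) (μ : Fin (d + 1)) (s t : BlkY x.toKIdx)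
    {Λ : SiteY x.toKIdx → Matrix (Fin N) (Fin N) ℂ} (hΛ : ∀ z, blkOf x.toKIdx.D.toDomains z ≠ s → Λ z = 0) :
    ∑ z ∈ Finset.univ.filter (fun z => blkOf x.toKIdx.D.toDomains z = t),
        ∑ a, ∑ b, ‖GsqY x.toKIdx (parSymY x.toKIdx) (cubeDomY x c) U (cutMulY (hTY x.toKIdx c) (cdsS x.toKIdx U μ Λ)) z a b‖ ^ 2
      ≤ (32 + 512 * ((5 * C1F d ℓ / 8) ^ 2 * (((ℓ + 1 : ℕ) : ℝ)) ^ 4)) * ((((ℓ + 1) ^ t.1.1 : ℕ) : ℝ)) ^ 2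
          / Real.exp ((1 / (4 * ((d : ℝ) + 2))) * (((((bondT x.toKIdx.D).dist t s : ℝ)) - 1) / (2 * ((ℓ + 1 : ℕ) : ℝ)) - 1)) ^ 2
        * trIP (fun _ => (1 : ℝ)) Λ Λ := by
  classical
  set K : ℝ := (5 * C1F d ℓ / 8) ^ 2 * (((ℓ + 1 : ℕ) : ℝ)) ^ 4 with hK
  set E : ℝ := Real.exp ((1 / (4 * ((d : ℝ) + 2))) * (((((bondT x.toKIdx.D).dist t s : ℝ)) - 1) / (2 * ((ℓ + 1 : ℕ) : ℝ)) - 1)) with hE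
  set Tt : ℝ := ((((ℓ + 1) ^ t.1.1 : ℕ) : ℝ)) ^ 2 with hTt
  have hE0 : 0 < E := Real.exp_pos _
  have hK0 : 0 ≤ K := by positivity
  have hTt0 : 0 ≤ Tt := by positivity
  have hQ0 : 0 ≤ trIP (fun _ => (1 : ℝ)) Λ Λ := trIP_self_nonneg _ (fun _ => one_pos) Λ
  have hRHS0 : 0 ≤ (32 + 512 * K) * Tt / E ^ 2 * trIP (fun _ => (1 : ℝ)) Λ Λ := by positivity
  -- the degenerate output level: the local inverse's output lives on `□̃(c)`
  by_cases ht : t.1.1 ≤ c.1.1 + 1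
  swap
  · refine le_of_eq_of_le ?_ hRHS0
    refine Finset.sum_eq_zero fun z hz => ?_
    rw [Finset.mem_filter] at hz
    rw [GsqY_cubeDomY_apply_eq_zero_of_lev x c U _ (by rw [hz.2]; omega)]
    simp
  -- the degenerate source level: the leg's input vanishes
  by_cases hs : s.1.1 ≤ c.1.1 + 2
  swap
  · refine le_of_eq_of_le ?_ hRHS0
    refine Finset.sum_eq_zero fun z _ => ?_
    rw [cutMulY_cdsS_eq_zero_of_lev x c U μ s hΛ (by omega), map_zero]
    change ∑ a, ∑ b, ‖(0 : Matrix (Fin N) (Fin N) ℂ) a b‖ ^ 2 = 0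
    simp
  -- the main case: §1 at `h = hTY c`, `D = cubeDomY x c`, `A = Δ(t)`, `n = d_T(t,s)`, `j_A = lev t`
  set κ : ℝ := C1F d ℓ / (8 / 5 * (bigSide ℓ x.toKIdx.Mh c.1.1 : ℝ)) with hκ
  have hA : ∀ z ∈ Finset.univ.filter (fun z => blkOf x.toKIdx.D.toDomains z = t), (bondT x.toKIdx.D).dist t s ≤ (bondT x.toKIdx.D).dist (blkOf x.toKIdx.D.toDomains z) s := by
    intro z hz; rw [Finset.mem_filter] at hz; rw [hz.2]
  have hjA : ∀ z ∈ Finset.univ.filter (fun z => blkOf x.toKIdx.D.toDomains z = t), (blkOf x.toKIdx.D.toDomains z).1.1 ≤ t.1.1 := by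
    intro z hz; rw [Finset.mem_filter] at hz; rw [hz.2]
  have key := hs_restrict_GsqY_cutMulY_cdsS_le_distT x.toKIdx hG (U := U) hC0 hC1 hreg (cubeDomY x c) (abs_hTY_le_one x.toKIdx c)
    (fun μ' z => abs_hTY_shiftY_sub_le x.toKIdx c μ' z) μ s hΛ hA hjA
  rw [← hκ, ← hTt] at key
  refine key.trans (mul_le_mul_of_nonneg_right (div_le_div_of_nonneg_right ?_ (by positivity)) hQ0)
  have hpow : ((((ℓ + 1) ^ (s.1.1 + 1) : ℕ) : ℝ)) ^ 2 ≤ ((((ℓ + 1) ^ (c.1.1 + 3) : ℕ) : ℝ)) ^ 2 := by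
    have h1 : (((ℓ + 1) ^ (s.1.1 + 1) : ℕ) : ℝ) ≤ (((ℓ + 1) ^ (c.1.1 + 3) : ℕ) : ℝ) := by exact_mod_cast Nat.pow_le_pow_right (Nat.succ_pos ℓ) (by omega)
    exact pow_le_pow_left₀ (by positivity) h1 2
  have hKc := kappa_sq_pow_le x c.1.1
  rw [← hκ] at hKc
  have hS2 : κ ^ 2 * ((((ℓ + 1) ^ (s.1.1 + 1) : ℕ) : ℝ)) ^ 2 ≤ K := le_trans (mul_le_mul_of_nonneg_left hpow (sq_nonneg κ)) hKc
  nlinarith [hS2, hK0, hTt0, mul_nonneg hK0 hTt0, mul_le_mul_of_nonneg_right hS2 hTt0]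

end Record

end Literature.MathematicalPhysics.QuantumFieldTheory.Balaban1983to89.B9Eq346OneSidedLegsAtCubesTorusL2

end
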